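import Literature.NumberTheory.EllipticCurves.IwasawaAlgebraSpecializationCountProofs
import Literature.NumberTheory.EllipticCurves.IwasawaAlgebraSpecializationIndexComparisonProofs
import HarnessLib

/-!
# Specialised indices `#(N ⧸ q_m N) ≍ p^{m μ(N)}` at Howard's primes `q_m = T^m + p`, and the `μ`-inequality
# from a uniform specialised index inequality (module theory over `Λ = ℤ_p⟦T⟧`; proofs file)

Topic `NumberTheory/EllipticCurves`. THEOREMS ONLY (no definition, no named fact, no `sorry`), on the vocabulary
of `IwasawaAlgebra.lean` (`muInvariant`, `Module.lengthAt`, `elementaryModule`) and its proof files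
(`exists_isPseudoIsomorphism_elementary_holds`, `muInvariant_eq_sum_holds`, `finite_of_isPseudoNull`), this seat's
`IwasawaAlgebraSpecializationCountProofs` (the exact count `#(E(μs, fs) ⧸ q_m)`) and seat x10b-p1-w2's
`IwasawaAlgebraSpecializationIndexComparisonProofs` (index comparison under a pseudo-isomorphism,
`LinearMap.IsPseudoIsomorphism.exists_card_quotient_le`; the exponent comparison `le_of_forall_pow_mul_le`). Written by the LEAD seat of line «twins»
on the crux `PrintX10b.BeyondCarrierDepthX10b` (stmt-BirchSwinnertonDyer-23055; cell `bsd-print-x9`) as the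
ALGEBRAIC HALF (piece (E), typed stub `mu_le_two_mu_of_specCard_le`) of the crux idea `specialise-first-mu-x10b`
(bsd-idea-16) for the one beyond-print stub of the Heegner-point cruxes of rows 9/10 (`s_mu` / `stub_muPartSharp`
of 27275 and 27077, `s2c` of 23055): Howard proves the `μ`-part of `char(X_tors) ∣ char(𝔖/ℋ)²` by
SPECIALISING the `Λ`-adic Kolyvagin system at the Eisenstein height-one primes `q_m = (T^m + p)` ([Howard 2004],
proof of Thm. 2.2.10: «the case `𝔭 = pΛ` is dealt with in an entirely similar fashion, taking `𝔮 = T^m + p`»)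
and letting `m → ∞`; the specialised bounds have the shape `#(N ⧸ q_m N) ≤ p^C · #(N' ⧸ q_m N')²` with `C`
independent of `m`. THIS FILE turns such a uniform family into the `μ`-INEQUALITY `μ(N) ≤ 2 μ(N')` — pure
`Λ`-module algebra; the ARITHMETIC half (the specialised Kolyvagin bounds at `3 ∣ h_K`, small residual image) is
not here and is not in print. HONEST FRAMING: nothing about elliptic curves is asserted; BSD is not proved by
any of this.

WHAT (`q_m` spelled `PowerSeries.X ^ m + PowerSeries.C (p : ℤ_[p])`, `#(N ⧸ q_m N)` spelled
`Nat.card (N ⧸ (Ideal.span {q_m} • ⊤))`; no new definitions — the idea card's `specPoly`/`specCard` are these terms).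
* `moduleFinite_elementaryModule`; **`exists_card_quotSMulTop_qm_bounds`** — for a finitely generated torsion `Λ`-module `N` there are `B ≥ 1`, `m₀`
  such that for all `m ≥ m₀`: `N ⧸ q_m N` is finite, `p^{m μ(N)} ≤ B · #(N ⧸ q_m N)` and
  `#(N ⧸ q_m N) ≤ B · p^{m μ(N)}` (structure theorem up to a pseudo-isomorphism `θ : N → E(μs, fs)` with finite
  kernel and cokernel; exact count of `E ⧸ q_m E`; `μ(N) = Σ μᵢ`; index bounds along `θ`).
* **`muInvariant_le_two_mul_of_card_quotSMulTop_qm_le`** — if `#(N ⧸ q_m N) ≤ p^C · #(N' ⧸ q_m N')²` for all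
  `m ≥ m₀`, then `μ(N) ≤ 2 μ(N')` (`p^{m(μ - 2μ')} ≤ const` for all large `m`).
* `span_natCast_eq_augIdealP`; **`lengthAt_le_two_mul_of_card_quotSMulTop_qm_le`** — the same in local-length
  currency at `𝔭 = (p)`, the hypothesis shape of the promotion lemma
  `IwasawaAlgebra.sq_charIdeal_le_charIdeal_of_span_p_pow_mul_le_of_lengthAt_le_two_mul` and of the by-signature
  witnesses `…_of_muInvariant_le` of the cruxes' `μ`-stubs.

References: [Howard2004HeegnerKolyvagin] B. Howard, *The Heegner point Kolyvagin system*, Compositio Math. 140 (2004),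
proof of Thm. 2.2.10 (arXiv:1202.6340, p. 18); [MazurRubin2004] B. Mazur, K. Rubin, *Kolyvagin systems*, Mem. AMS
799, §5.3; [Washington1997] §13.2 (Thm. 13.12, invariants `μ`, `λ`); [NeukirchSchmidtWingberg2008] Ch. V §1 (5.1.4)
Remark 4 (pseudo-null = finite over `Λ`).
-/

set_option autoImplicit false

noncomputable section

open scoped Classical Pointwise Polynomial DirectSum

namespace Literature.NumberTheory.EllipticCurves

namespace IwasawaAlgebra

variable (p : ℕ) [Fact p.Prime]

/-- The elementary module is finitely generated over `Λ`. [cite: Washington1997, §13.2 (Lemma 13.7, Prop. 13.8, Thm. 13.12)] -/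
theorem moduleFinite_elementaryModule (μs : List ℕ) (fs : List (ℤ_[p][X] × ℕ)) :
    Module.Finite (IwasawaAlgebra p) (elementaryModule p μs fs) := by
  have e : elementaryModule p μs fs ≃ₗ[IwasawaAlgebra p]
      ((⨁ i : Fin μs.length,
          IwasawaAlgebra p ⧸ Ideal.span {PowerSeries.C ((p : ℤ_[p]) ^ μs.get i)}) ×
        ⨁ j : Fin fs.length,
          IwasawaAlgebra p ⧸ Ideal.span {((fs.get j).1 : IwasawaAlgebra p) ^ (fs.get j).2}) :=
    LinearEquiv.refl _ _
  -- (`Module.Finite` of a product of direct sums is assembled through the `Π`-types: the direct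
  -- instance search does not unfold the `DirectSum` structures inside a product)
  haveI : Module.Finite (IwasawaAlgebra p)
      ((⨁ i : Fin μs.length,
          IwasawaAlgebra p ⧸ Ideal.span {PowerSeries.C ((p : ℤ_[p]) ^ μs.get i)}) ×
        ⨁ j : Fin fs.length,
          IwasawaAlgebra p ⧸ Ideal.span {((fs.get j).1 : IwasawaAlgebra p) ^ (fs.get j).2}) :=
    Module.Finite.equiv ((DirectSum.linearEquivFunOnFintype (IwasawaAlgebra p) _ _).prodCongr
      (DirectSum.linearEquivFunOnFintype (IwasawaAlgebra p) _ _)).symm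
  exact Module.Finite.equiv e.symm

/-- **Specialised-index asymptotics** (the algebraic half of Howard's `μ`-device, proof of
[Howard 2004, Thm. 2.2.10] «taking `𝔮 = T^m + p`»): for a finitely generated torsion `Λ`-module `N`
there are `B ≥ 1` and `m₀` such that for every `m ≥ m₀` the quotient `N ⧸ q_m N`, `q_m = X^m + p`, is
finite and `p^{m μ(N)} ≤ B · #(N ⧸ q_m N)` and `#(N ⧸ q_m N) ≤ B · p^{m μ(N)}`. Proof: structure
theorem up to a pseudo-isomorphism `θ : N → E(μs, fs)` (`exists_isPseudoIsomorphism_elementary_holds`;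
finite kernel and cokernel, `finite_of_isPseudoNull`), the exact count
`#(E ⧸ q_m) = p^{m Σμᵢ + Σ nⱼ deg fⱼ}` (`card_elementaryModule_quotSMulTop_qm`), `μ(N) = Σ μᵢ`
(`muInvariant_eq_sum_holds`), and the index comparison along `θ`
(`LinearMap.IsPseudoIsomorphism.exists_card_quotient_le`, `LinearMap.finite_quotient_smul_top_iff_of_finite_ker_coker`,
seat x10b-p1-w2). [cite: Washington1997, §13.2 (Thm. 13.12 and the invariants μ, λ)]
[cite: Howard2004HeegnerKolyvagin, proof of Thm. 2.2.10 (the primes T^m + p)] -/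
theorem exists_card_quotSMulTop_qm_bounds (N : Type*) [AddCommGroup N] [Module (IwasawaAlgebra p) N]
    [Module.Finite (IwasawaAlgebra p) N] (hN : Module.IsTorsion (IwasawaAlgebra p) N) :
    ∃ B m₀ : ℕ, 0 < B ∧ ∀ m : ℕ, m₀ ≤ m →
      Finite (N ⧸ (Ideal.span {(PowerSeries.X ^ m + PowerSeries.C (p : ℤ_[p]) : IwasawaAlgebra p)} • ⊤ :
        Submodule (IwasawaAlgebra p) N)) ∧
      p ^ (m * muInvariant p N) ≤ B * Nat.card (N ⧸ (Ideal.span {(PowerSeries.X ^ m +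
        PowerSeries.C (p : ℤ_[p]) : IwasawaAlgebra p)} • ⊤ : Submodule (IwasawaAlgebra p) N)) ∧
      Nat.card (N ⧸ (Ideal.span {(PowerSeries.X ^ m + PowerSeries.C (p : ℤ_[p]) : IwasawaAlgebra p)} • ⊤ :
        Submodule (IwasawaAlgebra p) N)) ≤ B * p ^ (m * muInvariant p N) := by
  classical
  have hp : p.Prime := Fact.out
  obtain ⟨μs, fs, -, hfs, θ, hθ⟩ := exists_isPseudoIsomorphism_elementary_holds p N hN
  have hfs' : ∀ f ∈ fs, f.1.IsDistinguishedAt (IsLocalRing.maximalIdeal ℤ_[p]) := fun f hf => (hfs f hf).1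
  have hμ : muInvariant p N = μs.sum := muInvariant_eq_sum_holds p N hfs' ⟨θ, hθ⟩
  set E := elementaryModule p μs fs with hEdef
  haveI : Module.Finite (IwasawaAlgebra p) E := moduleFinite_elementaryModule p μs fs
  haveI : IsNoetherian (IwasawaAlgebra p) N := isNoetherian_of_isNoetherianRing_of_finite _ _
  haveI : Finite (LinearMap.ker θ) := finite_of_isPseudoNull p (LinearMap.ker θ) hθ.1
  haveI : Finite (E ⧸ LinearMap.range θ) := finite_of_isPseudoNull p (E ⧸ LinearMap.range θ) hθ.2
  obtain ⟨B, hB, hcmp⟩ := hθ.exists_card_quotient_le p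
  set lam : ℕ := ∑ j : Fin fs.length, (fs.get j).2 * (fs.get j).1.natDegree with hlamdef
  refine ⟨B * p ^ lam, lam + 1, Nat.mul_pos hB (pow_pos hp.pos _), fun m hm => ?_⟩
  have hm1 : 1 ≤ m := by omega
  have hm' : ∀ f ∈ fs, f.2 * f.1.natDegree < m := by
    intro f hf
    obtain ⟨j, hj⟩ := List.get_of_mem hf
    have hle : (fs.get j).2 * (fs.get j).1.natDegree ≤ lam :=
      Finset.single_le_sum (f := fun j : Fin fs.length => (fs.get j).2 * (fs.get j).1.natDegree)
        (fun _ _ => Nat.zero_le _) (Finset.mem_univ j)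
    rw [hj] at hle
    omega
  set q : IwasawaAlgebra p := PowerSeries.X ^ m + PowerSeries.C (p : ℤ_[p]) with hqdef
  -- the elementary side: exact count, hence finite
  have hE : Nat.card (E ⧸ (Ideal.span {q} • ⊤ : Submodule (IwasawaAlgebra p) E)) = p ^ (m * μs.sum + lam) :=
    card_elementaryModule_quotSMulTop_qm p hfs' hm1 hm'
  have hEfin : Finite (E ⧸ (Ideal.span {q} • ⊤ : Submodule (IwasawaAlgebra p) E)) :=
    Nat.finite_of_card_ne_zero (by rw [hE]; exact (pow_pos hp.pos _).ne')
  -- finiteness of `N ⧸ q N` along `θ`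
  have hEfin' : Finite (E ⧸ (q • ⊤ : Submodule (IwasawaAlgebra p) E)) :=
    Finite.of_equiv _ (Submodule.quotEquivOfEq _ _ (Submodule.ideal_span_singleton_smul q ⊤)).toEquiv
  have hNfin' : Finite (N ⧸ (q • ⊤ : Submodule (IwasawaAlgebra p) N)) :=
    (LinearMap.finite_quotient_smul_top_iff_of_finite_ker_coker θ q).mpr hEfin'
  have hNfin : Finite (N ⧸ (Ideal.span {q} • ⊤ : Submodule (IwasawaAlgebra p) N)) :=
    Finite.of_equiv _ (Submodule.quotEquivOfEq _ _ (Submodule.ideal_span_singleton_smul q ⊤)).toEquiv.symm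
  obtain ⟨h1, h2⟩ := hcmp q
  refine ⟨hNfin, ?_, ?_⟩
  · rw [hμ]
    calc p ^ (m * μs.sum) ≤ p ^ (m * μs.sum + lam) := Nat.pow_le_pow_right hp.pos (Nat.le_add_right _ _)
      _ = Nat.card (E ⧸ (Ideal.span {q} • ⊤ : Submodule (IwasawaAlgebra p) E)) := hE.symm
      _ ≤ B * Nat.card (N ⧸ (Ideal.span {q} • ⊤ : Submodule (IwasawaAlgebra p) N)) := h2
      _ ≤ B * p ^ lam * Nat.card (N ⧸ (Ideal.span {q} • ⊤ : Submodule (IwasawaAlgebra p) N)) :=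
          Nat.mul_le_mul_right _ (Nat.le_mul_of_pos_right _ (pow_pos hp.pos _))
  · rw [hμ]
    calc Nat.card (N ⧸ (Ideal.span {q} • ⊤ : Submodule (IwasawaAlgebra p) N))
          ≤ B * Nat.card (E ⧸ (Ideal.span {q} • ⊤ : Submodule (IwasawaAlgebra p) E)) := h1
      _ = B * p ^ lam * p ^ (m * μs.sum) := by rw [hE, pow_add]; ring

/-- **μ-TRANSFER: a specialised index inequality, uniform in `m`, gives the `μ`-inequality.** For
finitely generated torsion `Λ`-modules `N, N'`: if `#(N ⧸ q_m N) ≤ p^C · #(N' ⧸ q_m N')²` for all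
`m ≥ m₀` (`q_m = X^m + p`), then `μ(N) ≤ 2 μ(N')` (by the asymptotics, `p^{m μ(N)} ≤ const · p^{2 m μ(N')}`
for all large `m`; `le_of_forall_pow_mul_le`). The typed stub `mu_le_two_mu_of_specCard_le` of the crux idea
`specialise-first-mu-x10b`; in the Heegner-point setting `N = X_tors`, `N'` = `𝔖/ℋ_F` or `𝔖/Λκ_∞(C)`, and
the hypothesis is the specialised Kolyvagin-system bound at Howard's primes `q_m`.
[cite: Howard2004HeegnerKolyvagin, proof of Thm. 2.2.10 (specialisation at T^m + p)] [cite: Washington1997, §13.2] -/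
theorem muInvariant_le_two_mul_of_card_quotSMulTop_qm_le (N N' : Type*) [AddCommGroup N]
    [Module (IwasawaAlgebra p) N] [AddCommGroup N'] [Module (IwasawaAlgebra p) N']
    [Module.Finite (IwasawaAlgebra p) N] [Module.Finite (IwasawaAlgebra p) N']
    (hN : Module.IsTorsion (IwasawaAlgebra p) N) (hN' : Module.IsTorsion (IwasawaAlgebra p) N')
    (h : ∃ C m₀ : ℕ, ∀ m : ℕ, m₀ ≤ m →
      Nat.card (N ⧸ (Ideal.span {(PowerSeries.X ^ m + PowerSeries.C (p : ℤ_[p]) : IwasawaAlgebra p)} • ⊤ :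
        Submodule (IwasawaAlgebra p) N)) ≤
      p ^ C * Nat.card (N' ⧸ (Ideal.span {(PowerSeries.X ^ m + PowerSeries.C (p : ℤ_[p]) :
        IwasawaAlgebra p)} • ⊤ : Submodule (IwasawaAlgebra p) N')) ^ 2) :
    muInvariant p N ≤ 2 * muInvariant p N' := by
  have hp : p.Prime := Fact.out
  obtain ⟨C, m₀, hC⟩ := h
  obtain ⟨B, m₁, -, h1⟩ := exists_card_quotSMulTop_qm_bounds p N hN
  obtain ⟨B', m₂, -, h2⟩ := exists_card_quotSMulTop_qm_bounds p N' hN'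
  refine le_of_forall_pow_mul_le hp.one_lt (D := B * p ^ C * B' ^ 2) (m₀ := max m₀ (max m₁ m₂))
    fun m hm => ?_
  have hm0 : m₀ ≤ m := le_trans (le_max_left _ _) hm
  have hm1 : m₁ ≤ m := le_trans (le_trans (le_max_left _ _) (le_max_right _ _)) hm
  have hm2 : m₂ ≤ m := le_trans (le_trans (le_max_right _ _) (le_max_right _ _)) hm
  obtain ⟨-, hlow, -⟩ := h1 m hm1
  obtain ⟨-, -, hup⟩ := h2 m hm2
  calc p ^ (m * muInvariant p N) ≤ B * Nat.card (N ⧸ _) := hlow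
    _ ≤ B * (p ^ C * Nat.card (N' ⧸ _) ^ 2) := Nat.mul_le_mul_left _ (hC m hm0)
    _ ≤ B * (p ^ C * (B' * p ^ (m * muInvariant p N')) ^ 2) := by gcongr
    _ = B * p ^ C * B' ^ 2 * p ^ (m * (2 * muInvariant p N')) := by ring

/-- `(p) = augIdealP`: the height-one prime `(p)` written with the natural-number cast.
[cite: Washington1997, §13.2 (the prime (p) and μ)] -/
theorem span_natCast_eq_augIdealP : Ideal.span {(p : IwasawaAlgebra p)} = augIdealP p := by
  rw [augIdealP, map_natCast]

/-- **μ-transfer, local-length currency**: under the same uniform specialised index inequality,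
`length_{Λ_(p)} N_(p) ≤ 2 · length_{Λ_(p)} N'_(p)` at the prime `𝔭 = (p)` — the hypothesis shape of the
promotion lemma `IwasawaAlgebra.sq_charIdeal_le_charIdeal_of_span_p_pow_mul_le_of_lengthAt_le_two_mul` and of
the by-signature witnesses `…_of_muInvariant_le` / `…_of_muInequality` of the cruxes' `μ`-stubs.
[cite: Howard2004HeegnerKolyvagin, proof of Thm. 2.2.10] [cite: Washington1997, §13.2] -/
theorem lengthAt_le_two_mul_of_card_quotSMulTop_qm_le (N N' : Type*) [AddCommGroup N]
    [Module (IwasawaAlgebra p) N] [AddCommGroup N'] [Module (IwasawaAlgebra p) N']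
    [Module.Finite (IwasawaAlgebra p) N] [Module.Finite (IwasawaAlgebra p) N']
    (hN : Module.IsTorsion (IwasawaAlgebra p) N) (hN' : Module.IsTorsion (IwasawaAlgebra p) N')
    (h : ∃ C m₀ : ℕ, ∀ m : ℕ, m₀ ≤ m →
      Nat.card (N ⧸ (Ideal.span {(PowerSeries.X ^ m + PowerSeries.C (p : ℤ_[p]) : IwasawaAlgebra p)} • ⊤ :
        Submodule (IwasawaAlgebra p) N)) ≤
      p ^ C * Nat.card (N' ⧸ (Ideal.span {(PowerSeries.X ^ m + PowerSeries.C (p : ℤ_[p]) :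
        IwasawaAlgebra p)} • ⊤ : Submodule (IwasawaAlgebra p) N')) ^ 2)
    (𝔭 : PrimeSpectrum (IwasawaAlgebra p)) (h𝔭 : 𝔭.asIdeal = Ideal.span {(p : IwasawaAlgebra p)}) :
    Module.lengthAt (IwasawaAlgebra p) N 𝔭 ≤ 2 * Module.lengthAt (IwasawaAlgebra p) N' 𝔭 := by
  have h1 := muInvariant_le_two_mul_of_card_quotSMulTop_qm_le p N N' hN hN' h
  have h𝔭' : 𝔭.asIdeal = augIdealP p := by rw [h𝔭, span_natCast_eq_augIdealP]
  have hN1 := Literature.NumberTheory.EllipticCurves.lengthAt_ne_top_of_isTorsion p N hN 𝔭 h𝔭'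
  have hN2 := Literature.NumberTheory.EllipticCurves.lengthAt_ne_top_of_isTorsion p N' hN' 𝔭 h𝔭'
  rw [Literature.NumberTheory.EllipticCurves.muInvariant_eq_toNat_lengthAt p N 𝔭 h𝔭',
    Literature.NumberTheory.EllipticCurves.muInvariant_eq_toNat_lengthAt p N' 𝔭 h𝔭'] at h1
  rw [← ENat.coe_toNat hN1, ← ENat.coe_toNat hN2]
  exact_mod_cast h1

end IwasawaAlgebra

end Literature.NumberTheory.EllipticCurves

end
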